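import Summits.ResolutionOfSingularities.ResolutionOfSingularities.Theorems.EquisingularLiftEquisingularLiftNatRegularOfFibreModel
import Mathlib.RingTheory.Nakayama
import HarnessLib

/-!
# EL♮(3), WIDTH TABLE W₂ «Σ-SECTION ROUND» (desk RULING R73), supply (u2):
# «A FLAT LIFT OF A CARTIER-BY-PARAMETER DIVISOR IS PRINCIPAL AND REGULAR» — the centre of `TowerSecRoundΣ` / (HR-SEC) upstairs

res-L1-w45b-nose-w1 g6 (WIDTH seat D-0157 DOOR 1; R73 (ii) DEFAULT OWNER of (u2)).  Letter of record (res-L1-w45b-idea-2 `SIGMA-NFF-NOTE.md` v1.1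
b12ccb17cb33562b §2 (L2)/(u2); res-L1-w45b-idea-3 `W2-SECTION-ROUND-idea3.md`; res-type-027's door `…NatResidueHypDefs11` (HR-SEC), (L2) verbatim):
downstairs, at a closed point `z` of the centre `Z ⊆ Ẽ`, «`𝓘⟨Z⟩_z = 𝓘⟨E⟩_z + (f)` with `f ∉ 𝓘⟨E⟩_z + 𝔪_z²`» — `Z̃` is cut on the host `Ẽ` by ONE element that is a
PARAMETER of `Ẽ` at `z` (no regularity of `Ẽ`, `Z̃` or the ambient is read).  Upstairs the host carries a MODEL `𝓔` (`TCPlus.LetterDatum`: `V(𝓔)` regular,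
`O`-flat, reduced trace `E`) and ✓ `embeddedLiftFact_holds` (p704265) delivers an `O`-FLAT lift `C ⊇ 𝓔` of `Z̃` inside `V(𝓔)` with reduced trace
`C·𝒪_G = 𝓘⟨Z⟩`.  THIS MODULE = the one new lemma (u2) of the engine bullet: such a lift is, at every point over `z`, `𝓔` PLUS ONE PARAMETER, hence
`V(C)` is REGULAR there; with `V(C)` proper over `O`, `V(C)` is a regular scheme — i.e. the section round's centre is a regular `O`-flat model with
reduced trace, exactly the HEND-block input of ✓ `noseRound_stage_of_model` (p702606) / the tail engine's branch-1 round bullet.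

* ★ `SectionLift.principal_regular_of_flat_lift` — PURE ALGEBRA: `π : A ↠ B` local rings, `ker π = (ϖ)`, `ϖ ∈ 𝔪_A`, `A` Noetherian; ideals `E ≤ J ≤ 𝔪_A`
  with `ϖ` a non-zero-divisor modulo `J` (flatness), `A ⧸ E` REGULAR, and downstairs `π(J) = π(E) + (f)` with `f ∉ π(E) + 𝔪_B²` ⇒
  `∃ c ∈ J`, `π c = f`, `J = E + (c)`, `c ∉ E + 𝔪_A²`, and `A ⧸ J` is a REGULAR local ring.
  (NAKAYAMA: `J ⊆ E + (c) + ϖ·J` since `ker π = (ϖ)` and `(J : ϖ) = J`; then Matsumura 14.2 in the regular `A ⧸ E`: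
  ✓ `IsRegularLocalRing.quotient_span_singleton`.)
* ★ `SectionLift.isRegularLocalRing_quotient_stalkIdeal_of_paramLift` — MODEL SQUARE over a DVR (`(j, t; r, Spec θ)` cartesian, `X` locally
  Noetherian): ideal sheaves `𝓔 ≤ C` on `X`, `V(C) → Spec O` flat, `z₀` a special-fibre point in the support of `C·𝒪_F`, `𝒪_{X,j z₀} ⧸ 𝓔_{j z₀}`
  regular, and (L2) for the traces `C·𝒪_F ⊇ 𝓔·𝒪_F` at `z₀` ⇒ `𝒪_{X,j z₀} ⧸ C_{j z₀}` REGULAR and `C_{j z₀} = 𝓔_{j z₀} + (c)` with `c ∉ 𝓔_{j z₀} + 𝔪²`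
  (the square's stalk map `j♯` is onto with kernel `(ϖ̃)`, ✓ `ker_stalkMap_model_le` / `stalkMap_model_varpi`; `ϖ̃`-regularity from flatness,
  ✓ `mem_stalkIdeal_of_varpi_mul_mem_of_flat`; traces = images, ✓ `stalkIdeal_comap_eq_map_stalkMap`).
* ★ `SectionLift.isRegular_subscheme_of_paramLift` — GLOBAL: if moreover `V(𝓔)` is a regular scheme, `V(C) → Spec O` is PROPER and (L2) holds at
  every CLOSED special-fibre point of the support of `C·𝒪_F`, then `V(C)` is a REGULAR scheme (every point of the proper `V(C)` specialises to a
  closed point over the closed point of `O`; ✓ `Scheme.isRegular_subscheme_of_forall_over_closedPoint` pattern + generisation).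

Pure commutative algebra + the chain's model-square bookkeeping; no new fact; DEF-FREE; no `sorry`; standard axioms;
`--supports stmt-ResolutionOfSingularities-20148 --as helper`, counted 0.  EL♮(3) is NOT proved; resolution of singularities in positive characteristic is
NOT proved anywhere in this tree (dim 3 in print: Cossart–Piltant 2008/2009); nothing of [Hironaka2017] is asserted.  References (method only):
H. Matsumura, *Commutative Ring Theory* (1986), Thm. 14.2, Thm. 2.2 (Nakayama); Stacks 00DV.
-/

set_option linter.dupNamespace false -- mandated namespace `Summit.<Summit>.<Problem>` of this single-conjunct summit

noncomputable section

open CategoryTheory CategoryTheory.Limits AlgebraicGeometry TopologicalSpace Topology IsLocalRing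
open Literature.AlgebraicGeometry.Resolution
open AlgebraicGeometry.Scheme.IdealSheafData
open Summit.ResolutionOfSingularities.ResolutionOfSingularities.Cruxes.EquisingularLift.StrataSplit

namespace Summit.ResolutionOfSingularities.ResolutionOfSingularities.Cruxes.EquisingularLiftNat.Sections.SectionLift

open Summit.ResolutionOfSingularities.ResolutionOfSingularities.Cruxes.EquisingularLiftNat.Sections
open Summit.ResolutionOfSingularities.ResolutionOfSingularities.Cruxes.EquisingularLiftNat.Sections.Equinodal

/-! ## §1 Pure algebra: a `ϖ`-flat lift of «`E` plus one parameter» is «`E` plus one parameter», hence regular -/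

/-- ★ **A FLAT LIFT OF A CARTIER-BY-PARAMETER DIVISOR IS PRINCIPAL AND REGULAR (pure algebra).**  `π : A ↠ B` a surjection of local rings with
kernel `(ϖ)`, `ϖ ∈ 𝔪_A`, `A` Noetherian; `E ≤ J ≤ 𝔪_A` ideals of `A` with `ϖ` a non-zero-divisor modulo `J` and `A ⧸ E` a REGULAR local ring;
downstairs `π(J) = π(E) + (f)` with `f ∉ π(E) + 𝔪_B²`.  Then `J = E + (c)` for some `c ∈ J` over `f`, `c ∉ E + 𝔪_A²`, and `A ⧸ J` is a regular
local ring.  [folklore; Nakayama + Matsumura 14.2] [OURS · W₂ supply (u2); counted 0] -/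
theorem principal_regular_of_flat_lift {A B : Type*} [CommRing A] [CommRing B] [IsLocalRing A] [IsLocalRing B] [IsNoetherianRing A]
    (π : A →+* B) (hπ : Function.Surjective π) (ϖ : A) (hker : RingHom.ker π = Ideal.span {ϖ}) (hϖ : ϖ ∈ maximalIdeal A)
    (E J : Ideal A) (hEJ : E ≤ J) (hJ : J ≤ maximalIdeal A) (hflat : ∀ y, ϖ * y ∈ J → y ∈ J)
    (hE : IsRegularLocalRing (A ⧸ E))
    (f : B) (hJf : J.map π = E.map π ⊔ Ideal.span {f}) (hf2 : f ∉ E.map π ⊔ maximalIdeal B ^ 2) :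
    ∃ c ∈ J, π c = f ∧ J = E ⊔ Ideal.span {c} ∧ c ∉ E ⊔ maximalIdeal A ^ 2 ∧ IsRegularLocalRing (A ⧸ J) := by
  classical
  -- a lift `c ∈ J` of `f`
  have hfJ : f ∈ J.map π := by rw [hJf]; exact Ideal.mem_sup_right (Ideal.mem_span_singleton_self f)
  obtain ⟨c, hcJ, hπc⟩ := (Ideal.mem_map_iff_of_surjective π hπ).mp hfJ
  -- `π (E + (c)) = π J`
  have hmapN : (E ⊔ Ideal.span {c}).map π = J.map π := by
    rw [Ideal.map_sup, Ideal.map_span, Set.image_singleton, hπc, hJf]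
  -- NAKAYAMA: `J ≤ (E + (c)) + (ϖ)·J`
  have hle : J ≤ (E ⊔ Ideal.span {c}) ⊔ Ideal.span {ϖ} • J := by
    intro x hx
    have hx' : x ∈ ((E ⊔ Ideal.span {c}).map π).comap π := by
      rw [Ideal.mem_comap, hmapN]; exact Ideal.mem_map_of_mem π hx
    rw [Ideal.comap_map_of_surjective π hπ, ← RingHom.ker_eq_comap_bot, hker] at hx'
    obtain ⟨n, hn, m, hm, hnm⟩ := Submodule.mem_sup.mp hx'
    have hnJ : n ∈ J := (sup_le hEJ ((Ideal.span_singleton_le_iff_mem _).mpr hcJ)) hn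
    obtain ⟨y, hy⟩ := Ideal.mem_span_singleton'.mp hm
    have hyJ : y ∈ J := by
      apply hflat
      have : ϖ * y = x - n := by rw [mul_comm, hy]; exact (sub_eq_of_eq_add' hnm.symm).symm
      rw [this]; exact J.sub_mem hx hnJ
    refine Submodule.mem_sup.mpr ⟨n, hn, m, ?_, hnm⟩
    rw [← hy, mul_comm]
    exact Submodule.smul_mem_smul (Ideal.mem_span_singleton_self ϖ) hyJ
  have hjac : Ideal.span {ϖ} ≤ Ideal.jacobson ⊥ := by
    rw [IsLocalRing.jacobson_eq_maximalIdeal ⊥ bot_ne_top, Ideal.span_singleton_le_iff_mem]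
    exact hϖ
  have hJN : J = E ⊔ Ideal.span {c} :=
    le_antisymm (Submodule.le_of_le_smul_of_le_jacobson_bot ((isNoetherianRing_iff_ideal_fg A).mp inferInstance J) hjac hle)
      (sup_le hEJ ((Ideal.span_singleton_le_iff_mem _).mpr hcJ))
  -- `c ∉ E + 𝔪_A²` (read downstairs)
  have hmapm : (maximalIdeal A).map π = maximalIdeal B := IsLocalRing.map_maximalIdeal_of_surjective π hπ
  have hc2 : c ∉ E ⊔ maximalIdeal A ^ 2 := by
    intro hc
    apply hf2
    have h := Ideal.mem_map_of_mem π hc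
    rw [Ideal.map_sup, Ideal.map_pow, hmapm, hπc] at h
    exact h
  -- REGULARITY: `A ⧸ J ≅ (A ⧸ E) ⧸ (c̄)` with `c̄` a parameter of the regular `A ⧸ E`
  have hEne : E ≠ ⊤ := fun h => (maximalIdeal.isMaximal A).ne_top (top_le_iff.mp (h ▸ hEJ.trans hJ))
  haveI : Nontrivial (A ⧸ E) := Ideal.Quotient.nontrivial_iff.mpr hEne
  have hmE : maximalIdeal (A ⧸ E) = (maximalIdeal A).map (Ideal.Quotient.mk E) := maximalIdeal_quotient_eq_map E
  have hcm : Ideal.Quotient.mk E c ∈ maximalIdeal (A ⧸ E) := by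
    rw [hmE]; exact Ideal.mem_map_of_mem _ (hJ hcJ)
  have hcm2 : Ideal.Quotient.mk E c ∉ maximalIdeal (A ⧸ E) ^ 2 := by
    intro h
    apply hc2
    rw [hmE, ← Ideal.map_pow] at h
    have h' := Ideal.mem_comap.mpr h
    rw [Ideal.comap_map_of_surjective _ Ideal.Quotient.mk_surjective, ← RingHom.ker_eq_comap_bot, Ideal.mk_ker] at h'
    simpa only [sup_comm] using h'
  have hregq := (IsRegularLocalRing.quotient_span_singleton hcm hcm2).1
  have e : (A ⧸ E) ⧸ Ideal.span {Ideal.Quotient.mk E c} ≃+* A ⧸ J := by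
    have hspan : Ideal.span {Ideal.Quotient.mk E c} = (Ideal.span {c}).map (Ideal.Quotient.mk E) := by
      rw [Ideal.map_span, Set.image_singleton]
    exact ((Ideal.quotEquivOfEq hspan).trans (DoubleQuot.quotQuotEquivQuotSup E (Ideal.span {c}))).trans
      (Ideal.quotEquivOfEq hJN.symm)
  exact ⟨c, hcJ, hπc, hJN, hc2, IsRegularLocalRing.of_ringEquiv e⟩

/-! ## §2 In the chain's model square over a DVR -/

section Model

variable (O : Type) [CommRing O] [IsDomain O] [IsDiscreteValuationRing O] (k : Type) [Field k] (θ : O →+* k)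
  (hθ : Function.Surjective θ) {X F : Scheme.{0}} (r : X ⟶ Spec (.of O)) (j : F ⟶ X) (t : F ⟶ Spec (.of k))
  (hsq : IsPullback j t r (Spec.map (CommRingCat.ofHom θ)))

include hθ hsq in
/-- ★ **(u2) AT A SPECIAL-FIBRE POINT, in a model square over a DVR.**  `X` locally Noetherian, `𝓔 ≤ C` ideal sheaves on `X` with `V(C) → Spec O`
FLAT, `z₀` a point of the special fibre `F` in the support of the trace `C·𝒪_F`, `𝒪_{X,j z₀} ⧸ 𝓔_{j z₀}` regular (the host's model is regular there),
and (L2) for the traces at `z₀`: `(C·𝒪_F)_{z₀} = (𝓔·𝒪_F)_{z₀} + (f)` with `f ∉ (𝓔·𝒪_F)_{z₀} + 𝔪_{z₀}²`.  Then `𝒪_{X,j z₀} ⧸ C_{j z₀}` is a REGULAR local ring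
and `C_{j z₀} = 𝓔_{j z₀} + (c)` with `c ∉ 𝓔_{j z₀} + 𝔪²`.  [folklore; §1 on the square's stalk map] [OURS · W₂ supply (u2); counted 0] -/
theorem isRegularLocalRing_quotient_stalkIdeal_of_paramLift [IsLocallyNoetherian X] (𝓔 C : X.IdealSheafData)
    [Flat (C.subschemeι ≫ r)] (h𝓔C : 𝓔 ≤ C) (z₀ : F) (hz₀ : z₀ ∈ ((C.comap j).support : Set F))
    (hEreg : IsRegularLocalRing (X.presheaf.stalk (j z₀) ⧸ stalkIdeal 𝓔 (j z₀)))
    (hL2 : ∃ f : F.presheaf.stalk z₀, stalkIdeal (C.comap j) z₀ = stalkIdeal (𝓔.comap j) z₀ ⊔ Ideal.span {f} ∧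
      f ∉ stalkIdeal (𝓔.comap j) z₀ ⊔ maximalIdeal (F.presheaf.stalk z₀) ^ 2) :
    IsRegularLocalRing (X.presheaf.stalk (j z₀) ⧸ stalkIdeal C (j z₀)) ∧
      ∃ c : X.presheaf.stalk (j z₀), stalkIdeal C (j z₀) = stalkIdeal 𝓔 (j z₀) ⊔ Ideal.span {c} ∧
        c ∉ stalkIdeal 𝓔 (j z₀) ⊔ maximalIdeal (X.presheaf.stalk (j z₀)) ^ 2 := by
  -- adapted from Summits/…/EquisingularLiftEquisingularLiftNatRegularOfFibreModel.lean (res-L1-w45b-stub-2, W5a-model): same square bookkeeping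
  obtain ⟨ϖ, hϖ⟩ := IsDiscreteValuationRing.exists_irreducible O
  haveI : IsClosedImmersion (Spec.map (CommRingCat.ofHom θ)) := IsClosedImmersion.spec_of_surjective _ hθ
  haveI : IsClosedImmersion j := MorphismProperty.IsStableUnderBaseChange.of_isPullback hsq.flip inferInstance
  set A := X.presheaf.stalk (j z₀) with hA
  set J : Ideal A := stalkIdeal C (j z₀) with hJ
  set EA : Ideal A := stalkIdeal 𝓔 (j z₀) with hEA
  set ϖb : A := (X.presheaf.Γgerm (j z₀)).hom (r.appTop.hom ((Scheme.ΓSpecIso (.of O)).inv.hom ϖ)) with hϖb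
  -- the point lies over the closed point and in the support of `C`
  have hrb : r (j z₀) = closedPoint O := by
    have : j z₀ ∈ Set.range j := ⟨z₀, rfl⟩
    rw [range_eq_preimage_of_isPullback hsq, range_specMap_of_surjective_of_field θ hθ] at this
    exact this
  have hb : j z₀ ∈ (C.support : Set X) := by
    rw [Scheme.IdealSheafData.support_comap] at hz₀; exact hz₀
  have hJle : J ≤ maximalIdeal A := (mem_support_iff_stalkIdeal_le C (j z₀)).mp hb
  have hϖm : ϖb ∈ maximalIdeal A := CILift.germ_varpi_mem_maximalIdeal O r ϖ hϖ (j z₀) hrb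
  -- the square's stalk map `π = j♯_{z₀}`: onto, kernel `(ϖ̃)`
  set π : A →+* F.presheaf.stalk z₀ := (j.stalkMap z₀).hom with hπ
  have hπsurj : Function.Surjective π := j.stalkMap_surjective z₀
  have hkerπ : RingHom.ker π = Ideal.span {ϖb} := by
    refine le_antisymm (ker_stalkMap_model_le O k θ hθ r j t hsq z₀ ϖ hϖ) ?_
    rw [Ideal.span_le, Set.singleton_subset_iff, SetLike.mem_coe, RingHom.mem_ker]
    exact stalkMap_model_varpi θ hθ r j t hsq z₀ ϖ (hϖ.maximalIdeal_eq ▸ Ideal.mem_span_singleton_self ϖ)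
  -- flatness: `ϖ̃` is a non-zero-divisor modulo `J`
  have hflat : ∀ y : A, ϖb * y ∈ J → y ∈ J := fun y hy =>
    mem_stalkIdeal_of_varpi_mul_mem_of_flat r C (j z₀) hb hϖ.ne_zero y hy
  -- traces = images along `π`
  have hJtr : stalkIdeal (C.comap j) z₀ = J.map π := stalkIdeal_comap_eq_map_stalkMap j C z₀
  have hEtr : stalkIdeal (𝓔.comap j) z₀ = EA.map π := stalkIdeal_comap_eq_map_stalkMap j 𝓔 z₀
  obtain ⟨f, hf, hf2⟩ := hL2
  rw [hJtr, hEtr] at hf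
  rw [hEtr] at hf2
  obtain ⟨c, -, -, hJc, hc2, hreg⟩ := principal_regular_of_flat_lift π hπsurj ϖb hkerπ hϖm EA J
    (stalkIdeal_mono h𝓔C (j z₀)) hJle hflat hEreg f hf hf2
  exact ⟨hreg, c, hJc, hc2⟩

include hθ hsq in
/-- ★ **(u2) GLOBAL: THE SECTION ROUND'S CENTRE IS A REGULAR SCHEME.**  In the model square, `X` locally Noetherian, `𝓔 ≤ C` ideal sheaves with
`V(𝓔)` a REGULAR scheme (the host's model), `V(C) → Spec O` FLAT and PROPER, and (L2) for the traces at every CLOSED point of the special fibre in the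
support of `C·𝒪_F`: then `V(C)` is REGULAR.  (Every point of the proper `V(C)` specialises to a closed point over the closed point of `O`; there the
previous theorem applies; regularity generises.)  Together with flatness and the reduced trace this is the HEND-block input «regular `O`-flat model
with reduced trace» of ✓ `noseRound_stage_of_model` for the centre of `TowerSecRoundΣ` / (HR-SEC).  [folklore] [OURS · W₂ supply (u2); counted 0] -/
theorem isRegular_subscheme_of_paramLift [IsLocallyNoetherian X] (𝓔 C : X.IdealSheafData)
    [Flat (C.subschemeι ≫ r)] [IsProper (C.subschemeι ≫ r)] (h𝓔C : 𝓔 ≤ C)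
    (hEreg : Scheme.IsRegular 𝓔.subscheme)
    (hL2 : ∀ z₀ : F, z₀ ∈ ((C.comap j).support : Set F) → IsClosed ({z₀} : Set F) →
      ∃ f : F.presheaf.stalk z₀, stalkIdeal (C.comap j) z₀ = stalkIdeal (𝓔.comap j) z₀ ⊔ Ideal.span {f} ∧
        f ∉ stalkIdeal (𝓔.comap j) z₀ ⊔ maximalIdeal (F.presheaf.stalk z₀) ^ 2) :
    Scheme.IsRegular C.subscheme := by
  haveI : IsClosedImmersion (Spec.map (CommRingCat.ofHom θ)) := IsClosedImmersion.spec_of_surjective _ hθ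
  haveI : IsClosedImmersion j := MorphismProperty.IsStableUnderBaseChange.of_isPullback hsq.flip inferInstance
  -- every point of `V(C)` specialises to a CLOSED point of `V(C)` over the closed point of `O`
  haveI : CompactSpace ↥C.subscheme := QuasiCompact.compactSpace_of_compactSpace (C.subschemeι ≫ r)
  intro s
  obtain ⟨s₀, hs₀, hs₀cl⟩ := (isClosed_closure (s := ({s} : Set ↥C.subscheme))).exists_closed_singleton ⟨s, subset_closure rfl⟩
  have hspec : s ⤳ s₀ := specializes_iff_mem_closure.mpr hs₀
  refine isRegularLocalRing_stalk_of_specializes hspec ?_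
  -- the closed point `s₀` lies over the closed point of `O`
  have hover : (C.subschemeι ≫ r) s₀ = closedPoint O := by
    have himg : IsClosed ({(C.subschemeι ≫ r) s₀} : Set (Spec (.of O))) := by
      have := (C.subschemeι ≫ r).isClosedMap _ hs₀cl
      rwa [Set.image_singleton] at this
    have hmax := (PrimeSpectrum.isClosed_singleton_iff_isMaximal ((C.subschemeι ≫ r) s₀)).mp himg
    exact PrimeSpectrum.ext (IsLocalRing.eq_maximalIdeal hmax)
  -- hence `x₀ := ι s₀ = j z₀` for a closed special-fibre point `z₀` in the support of the trace
  set x₀ : X := C.subschemeι s₀ with hx₀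
  have hx₀C : x₀ ∈ (C.support : Set X) := by
    rw [← Scheme.IdealSheafData.range_subschemeι]; exact ⟨s₀, rfl⟩
  have hx₀r : r x₀ = closedPoint O := by
    rw [hx₀]; simpa [Scheme.Hom.comp_base] using hover
  have hx₀j : x₀ ∈ Set.range j := by
    rw [range_eq_preimage_of_isPullback hsq, range_specMap_of_surjective_of_field θ hθ]; exact hx₀r
  obtain ⟨z₀, hz₀⟩ := hx₀j
  have hz₀supp : z₀ ∈ ((C.comap j).support : Set F) := by
    rw [Scheme.IdealSheafData.support_comap]; change j z₀ ∈ (C.support : Set X); rw [hz₀]; exact hx₀C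
  have hx₀cl : IsClosed ({x₀} : Set X) := by
    have := C.subschemeι.isClosedMap _ hs₀cl
    rwa [Set.image_singleton] at this
  have hz₀cl : IsClosed ({z₀} : Set F) := by
    have hpre : j ⁻¹' {x₀} = {z₀} := by
      ext z
      simp only [Set.mem_preimage, Set.mem_singleton_iff]
      constructor
      · intro h; exact j.isClosedEmbedding.injective (h.trans hz₀.symm)
      · rintro rfl; exact hz₀
    rw [← hpre]; exact hx₀cl.preimage j.continuous
  -- the host's model is regular at `x₀`
  have hEx₀ : x₀ ∈ (𝓔.support : Set X) := Scheme.IdealSheafData.support_antitone h𝓔C hx₀C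
  obtain ⟨e₀, he₀⟩ : x₀ ∈ Set.range 𝓔.subschemeι := by rw [Scheme.IdealSheafData.range_subschemeι]; exact hEx₀
  have hEreg₀ : IsRegularLocalRing (X.presheaf.stalk (j z₀) ⧸ stalkIdeal 𝓔 (j z₀)) := by
    rw [hz₀]
    exact (isRegularLocalRing_subscheme_stalk_iff_of_eq 𝓔 e₀ x₀ he₀).mp (hEreg e₀)
  -- §2 at `z₀`, read on `V(C)` at `s₀`
  have hmain := (isRegularLocalRing_quotient_stalkIdeal_of_paramLift O k θ hθ r j t hsq 𝓔 C h𝓔C z₀ hz₀supp hEreg₀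
    (hL2 z₀ hz₀supp hz₀cl)).1
  rw [hz₀] at hmain
  exact (isRegularLocalRing_subscheme_stalk_iff_of_eq C s₀ x₀ rfl).mpr hmain

end Model

end Summit.ResolutionOfSingularities.ResolutionOfSingularities.Cruxes.EquisingularLiftNat.Sections.SectionLift

end
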